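import Literature.NumberTheory.LFunctions.ZeroDensityThirtyThirteenths
import HarnessLib

/-!
# Guth–Maynard's Theorem 1.1 (large values estimate) as printed, with Theorems 1.2 and 1.6 as printed

A large values / zero-density theorem COUNTS zeros off the critical line; it never empties the
strip (`Literature.Barriers.RiemannHypothesis.LindelofBacklund`). NOT RH-BEARING: everything in
this file is RH-free literature, proved; nothing here is worded as, or is, progress toward RH.

Topic `NumberTheory/LFunctions`, family RH; a leaf above `ZeroDensityThirtyThirteenths.lean`
(hence above the whole Guth–Maynard programme `LargeValuesGuthMaynardReduction` (§3) …
`LargeValuesS3Bound` (§10), `LargeValuesEnergyBound` (§11), `LargeValuesAssembly` (§12),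
`ZeroDensityGuthMaynardWindow` (§13.1) of the tree). That programme PROVES the tree's named facts
`zeroDensity_guth_maynard` (Theorem 1.2 on `[7/10, 1]`, `zeroDensity_guth_maynard_holds`) and
`zeroDensity_thirty_thirteenths` (the `30/13` display after Theorem 1.2,
`zeroDensity_thirty_thirteenths_holds`), passing THROUGH Theorem 1.1 of the paper as an
intermediate term (`GuthMaynardReduction.largeValues_of_keyProp hw hKP`, for `1 ≤ N ≤ T` and
`T ≥ T₀(ε)`), but no standalone declaration of Theorem 1.1 existed. This file supplies the
AS-PRINTED standalone declarations of §1 of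
L. Guth, J. Maynard, *New large value estimates for Dirichlet polynomials*, Ann. of Math. (2) 203
(2026), 623–675 (= arXiv:2405.20552), and proves them from the tree:

* `GuthMaynard2026_theorem_1_1` — **Theorem 1.1 as printed** (no constraint between `N` and `T`;
  the `T^{o(1)}` of the paper's §1.2 read uniformly: for every `ε > 0` one constant `C_ε` for all
  `T ≥ 1`), and `GuthMaynard2026_theorem_1_1_holds`. Proof: for `T ≥ T₀(ε)`, `N ≤ T` this is the
  tree's term `GuthMaynardReduction.largeValues_of_keyProp` fed with Proposition 3.1, itself
  obtained exactly as in `GuthMaynardAssembly.zeroDensity_guth_maynard_of_bounds` from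
  `GuthMaynardAssembly.exists_weight`, `keyProp_of_bounds` (§12), `GuthMaynardS2.S2_bound`
  (Prop. 6.1), `GuthMaynardS3Final.S3_bound` (Prop. 10.1), `GuthMaynardEnergyBound.energy_bound`
  (Prop. 11.1); for `N > T` ("Theorem 1.1 follows from (1.1) if `N ≥ T` since then
  `R ≤ T^{o(1)}N²V⁻²`", §3) the LOG-FREE discrete mean value theorem on a dyadic range
  (`GuthMaynardLargeValues.discreteMeanValue_dyadic`, `largeValues_mvt_logFree`: the tree's
  `largeValues_mvt` carries a factor `1 + log 2N`, which is not `T^{o(1)}` when `N` is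
  exponentially larger than `T`; twisting by `N^{it}` before Gallagher's lemma removes it); for
  `1 ≤ T < T₀(ε)` the trivial count `#W ≤ T + 1` (`GuthMaynardReduction.card_le_of_one_sep`) and
  `N²V⁻² ≥ 1/4`. The equivalence of the uniform reading with the literal "for all large `T`"
  reading of §1.2 is `GuthMaynard2026_theorem_1_1_iff_eventually`; the tree's hypothesis shape
  `hLV` of `zeroDensity_guth_maynard_of_largeValues` is recovered by
  `GuthMaynard2026_theorem_1_1.largeValues_hLV`, whence Theorem 1.1 ⇒ Theorem 1.2 through §13.1 of
  the tree (`zeroDensity_guth_maynard_of_theorem_1_1`).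
* `GuthMaynard2026_theorem_1_2` — **Theorem 1.2 as printed**, i.e. with NO `σ`-range:
  `N(σ,T) ≤ T^{15(1−σ)/(3+5σ)+o(1)}` for every `1/2 ≤ σ ≤ 1` (the tree's `zeroDensity_guth_maynard`
  is the same estimate restricted to `σ ≥ 7/10`, where it is new; below `7/10` Ingham's exponent
  is smaller). `GuthMaynard2026_theorem_1_2_holds` is the tree's
  `zeroDensityEstimate_guth_maynard_half_iff` applied to `zeroDensity_guth_maynard_holds`.
  The `30/13` display after Theorem 1.2 is the tree's `zeroDensity_thirty_thirteenths(_holds)`;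
  Conjecture 1.5 is the tree's `@[conjecture] MontgomeryLargeValueConjecture` (a conjecture, not
  a fact); Corollaries 1.3–1.4 and Lemma 1.7 are other files of the cell.
* `GuthMaynard2026_theorem_1_6` — **Theorem 1.6 (Heath-Brown) as printed**: inclusive sum
  `∑_{n=N}^{2N}` and coefficients `|a_n| ≤ A` with the loss `A²` (the paper's `|a_n| ≤ T^{o(1)}`),
  from the tree's `HeathBrownDZS.heathBrown_differenceSet` (which has `N < n ≤ 2N`, `|a_n| ≤ 1`,
  and leaves exactly these two steps "to the user"); `GuthMaynard2026_theorem_1_6_holds`.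

Conventions (paper §1.2, p. 5 of the arXiv text): "`A ⪅ B` means that for any `ε > 0` there is a
constant `C(ε) > 0` depending only on `ε` such that `|A| ≤ C(ε) T^ε B` for all large `T`";
"asymptotic quantities such as `o(1)` are interpreted as `T → ∞`"; sums run over integers;
Theorem 1.1 prints the inclusive sum `∑_{n=N}^{2N}` (tree: `Finset.Icc N (2 * N)`). The paper's
`N(σ,T)` counts zeros with `|Im ρ| ≤ T` (both half-planes); the tree's `zetaZeroCountRe σ T` counts
`0 < Im ρ ≤ T` with multiplicity — a factor `2`, invisible in `≪ T^{…+ε}` statements. Junk-value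
guards `0 < V`, `1 ≤ N`, `1 ≤ T` are the implicit hypotheses of the printed statement (with
`V ≤ 0`, `N = 0` or `T < 1` the Lean right-hand sides degenerate). No named fact is introduced:
every `def … : Prop` below has its `_holds` theorem in this file.

## Main statements (all proved)

* `GuthMaynardLargeValues.discreteMeanValue_dyadic`, `GuthMaynardLargeValues.largeValues_mvt_logFree`
  — the log-free discrete mean value theorem on `N ≤ n ≤ M` and the resulting large values bound.
* `GuthMaynardLargeValues.theorem_1_1_of_restricted` — the passage from the tree's shape
  (`T ≥ T₀`, `N ≤ T`) to the printed one.
* `GuthMaynard2026_theorem_1_1_holds`, `GuthMaynard2026_theorem_1_1_iff_eventually`,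
  `GuthMaynard2026_theorem_1_1.largeValues_hLV`, `zeroDensity_guth_maynard_of_theorem_1_1`.
* `GuthMaynard2026_theorem_1_2_holds`, `GuthMaynard2026_theorem_1_6_holds`.

## References

* L. Guth, J. Maynard, *New large value estimates for Dirichlet polynomials*, Ann. of Math. (2)
  203 (2026), no. 2, 623–675; arXiv:2405.20552: Theorem 1.1, (1.1), Theorem 1.2 and the display
  following it, Theorem 1.6, §1.2 (conventions), §3 (proof of Theorem 1.1 assuming
  Proposition 3.1). [key `GuthMaynard2026`]
* D. R. Heath-Brown, *A large values estimate for Dirichlet polynomials*, J. London Math. Soc. (2)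
  20 (1979), 8–18, Theorem 1. [key `Heathbrown1979`]
* M. N. Huxley, *The Distribution of Prime Numbers*, Oxford 1972, Ch. 18 (Gallagher's lemma,
  (18.16)–(18.17)). [key `Huxley1972`]
-/

noncomputable section

open Real Set Filter Topology Complex MeasureTheory Finset Asymptotics

namespace Literature.NumberTheory.LFunctions

/-! ## §1. The statements as printed -/

/-- **Guth–Maynard, Theorem 1.1 (Large values estimate), as printed.** "Suppose `(b_n)` is a
sequence of complex numbers with `|b_n| ≤ 1`, and `(t_r)_{r≤R}` is a sequence of `1`-separated
points in `[0,T]` such that `|∑_{n=N}^{2N} b_n n^{it_r}| ≥ V` for all `r ≤ R`. Then we have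
`R ≤ T^{o(1)}(N²V⁻² + N^{18/5}V⁻⁴ + TN^{12/5}V⁻⁴)`." Here the finite `1`-separated set of points is
`W` (`R = #W`), the sum is over `Finset.Icc N (2N)` (inclusive, as printed), and `T^{o(1)}` is read
per the paper's §1.2 ("for any `ε > 0` there is `C(ε)` … `≤ C(ε)T^ε B`"), uniformly in all the
data: for every `ε > 0` ONE constant `C` serves all `T ≥ 1`, all `N ≥ 1` (no constraint between
`N` and `T` is printed and none is imposed), all `b`, `V > 0`, `W`. The literal "for all large `T`"
reading is equivalent (`GuthMaynard2026_theorem_1_1_iff_eventually`); `V > 0`, `N ≥ 1`, `T ≥ 1`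
are the implicit non-degeneracy hypotheses of the printed statement. (Source read at
arXiv:2405.20552 §1, first display; corpus-tex chunk p0003.)
[cite: GuthMaynard2026, Theorem 1.1 (arXiv:2405.20552v2 p. 1)] -/
def GuthMaynard2026_theorem_1_1 : Prop :=
  ∀ ε : ℝ, 0 < ε → ∃ C : ℝ, ∀ T : ℝ, 1 ≤ T →
    ∀ (N : ℕ) (b : ℕ → ℂ) (V : ℝ) (W : Finset ℝ), 1 ≤ N →
    (∀ n, ‖b n‖ ≤ 1) → 0 < V → (∀ t ∈ W, 0 ≤ t ∧ t ≤ T) →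
    (∀ t ∈ W, ∀ t' ∈ W, t ≠ t' → 1 ≤ |t - t'|) →
    (∀ t ∈ W, V ≤ ‖∑ n ∈ Finset.Icc N (2 * N), b n * (n : ℂ) ^ ((t : ℂ) * I)‖) →
    (W.card : ℝ) ≤ C * T ^ ε * ((N : ℝ) ^ 2 * V⁻¹ ^ 2 + (N : ℝ) ^ (18 / 5 : ℝ) * V⁻¹ ^ 4 +
      T * (N : ℝ) ^ (12 / 5 : ℝ) * V⁻¹ ^ 4)

/-- **Guth–Maynard, Theorem 1.2 (Zero density estimate), as printed.** "Let `N(σ,T)` denote the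
number of zeros `ρ` of `ζ(s)` with `Re(ρ) ≥ σ` and `|Im(ρ)| ≤ T`. Then we have
`N(σ,T) ≤ T^{15(1−σ)/(3+5σ)+o(1)}`." Printed with NO restriction on `σ`; recorded on the whole
range `1/2 ≤ σ ≤ 1` of zero-density theory in the tree's form `ZeroDensityEstimate` (per-`σ`
implied constants, `T^ε` form, `zetaZeroCountRe` counting `0 < Im ρ ≤ T` — half the printed
symmetric count, immaterial here). The tree's named fact `zeroDensity_guth_maynard` is the same
estimate on `[7/10, 1]` (where it is new); on `[1/2, 7/10]` the printed bound is weaker than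
Ingham's `T^{3(1−σ)/(2−σ)+o(1)}` (`3/(2−σ) ≤ 15/(3+5σ) ⟺ σ ≤ 7/10`). This Prop is literally the
left side of the tree's `zeroDensityEstimate_guth_maynard_half_iff`. (Source read at
arXiv:2405.20552 §1; corpus-tex chunk p0003.)
[cite: GuthMaynard2026, Theorem 1.2 (arXiv:2405.20552v2 p. 2)] -/
def GuthMaynard2026_theorem_1_2 : Prop :=
  ZeroDensityEstimate (fun σ ↦ 15 / (3 + 5 * σ)) (1 / 2)

/-- **Guth–Maynard, Theorem 1.6 (Heath-Brown [HB]), as printed.** "Suppose that `𝒯` is a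
`1`-separated set of points in an interval of length `T`. Let `|a_n| ≤ T^{o(1)}` be a complex
sequence. Then
`∑_{t₁,t₂∈𝒯} |∑_{n=N}^{2N} a_n n^{i(t₁−t₂)}|² ≤ T^{o(1)}(|𝒯|²N + |𝒯|N² + |𝒯|^{5/4}T^{1/2}N)`."
Read per §1.2 (`T^{o(1)}` as `T → ∞`: for every `ε > 0`, constants `C, T₀` and all `T ≥ T₀`) and,
the left side being quadratic in `(a_n)`, with the coefficient bound made explicit: `|a_n| ≤ A`
costs the factor `A²` (so `|a_n| ≤ T^δ` costs `T^{2δ}`, which is the printed `T^{o(1)}`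
hypothesis/conclusion). Inclusive sum `∑_{n=N}^{2N}` (`Finset.Icc`), `N ≥ 1`, finite `𝒯` in
`[T₁, T₁ + T]`. The tree's `HeathBrownDZS.heathBrown_differenceSet` is the same with `N < n ≤ 2N`
and `|a_n| ≤ 1` (Heath-Brown 1979, Theorem 1, via Ivić's Lemmas 11.4–11.5). (Source read at
arXiv:2405.20552 §1.1; corpus-tex chunk p0004.)
[cite: GuthMaynard2026, Theorem 1.6 (arXiv:2405.20552v2 p. 4)] [cite: Heathbrown1979, Theorem 1] -/
def GuthMaynard2026_theorem_1_6 : Prop :=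
  ∀ ε : ℝ, 0 < ε → ∃ C T₀ : ℝ, ∀ T : ℝ, T₀ ≤ T → ∀ (𝒯 : Finset ℝ) (T₁ : ℝ),
    (∀ t ∈ 𝒯, T₁ ≤ t ∧ t ≤ T₁ + T) → (∀ t ∈ 𝒯, ∀ t' ∈ 𝒯, t ≠ t' → 1 ≤ |t - t'|) →
    ∀ N : ℕ, 1 ≤ N → ∀ (A : ℝ) (a : ℕ → ℂ), (∀ n, ‖a n‖ ≤ A) →
      ∑ t₁ ∈ 𝒯, ∑ t₂ ∈ 𝒯,
          ‖∑ n ∈ Finset.Icc N (2 * N), a n * (n : ℂ) ^ (((t₁ - t₂ : ℝ) : ℂ) * I)‖ ^ 2 ≤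
        C * T ^ ε * A ^ 2 * ((𝒯.card : ℝ) ^ 2 * N + 𝒯.card * (N : ℝ) ^ 2 +
          (𝒯.card : ℝ) ^ (5 / 4 : ℝ) * T ^ (1 / 2 : ℝ) * N)

namespace GuthMaynardLargeValues

/-! ## §2. The log-free discrete mean value theorem on a dyadic range

The tree's `Gallagher.discreteMeanValue` bounds `∑_r |∑_{n=1}^{M} a_n n^{-it_r}|²` by
`(5(T + δ/2) + 18M)(δ⁻¹ + log M) ∑|a_n|²`; the `log M` comes from the derivative
`∑ (−i log n) a_n n^{-it}` in Gallagher's lemma. When `a_n` is supported on `N ≤ n ≤ M` one may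
first multiply by the unimodular `N^{it}`: the twisted polynomial `∑ a_n (n/N)^{-it}` has the same
modulus and derivative coefficients `−i log(n/N) a_n` of size `≤ log(M/N) |a_n|`, so `log M`
improves to `log(M/N)` (`= log 2` on a dyadic range). This is what makes the term `N²V⁻²` of
Guth–Maynard's (1.1) genuinely free of logarithms when `N ≥ T`. -/

open Gallagher in
/-- **The discrete mean value theorem for a Dirichlet polynomial supported on `[N, M]`, without the
logarithm of the length**: for `δ`-separated points `t ∈ 𝒯 ⊂ [−T, T]` (`T, δ > 0`), `1 ≤ N ≤ M`
and `a_n = 0` for `n < N`,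
`∑_{t∈𝒯} |∑_{n=1}^{M} a_n n^{-it}|² ≤ (5(T + δ/2) + 18M)(δ⁻¹ + log(M/N)) ∑_{n=1}^{M} |a_n|²`.
Gallagher's first lemma (`Gallagher.gallagher_first_lemma`, Huxley 1972 Ch. 18 (18.17)) applied
to `F(t) = N^{it} ∑ a_n n^{-it}`, whose derivative is `N^{it} ∑ i(log N − log n) a_n n^{-it}`, and
the tree's integral mean value theorem `dirichletPolynomial_meanSquare_le` for both. This is the
discrete mean value theorem of Davenport–Montgomery in Huxley's form (18.27)–(18.29)
("`∑_r |f(t_r)|² ≤ (δ⁻¹ + log N)(T₂ − T₁ + O(N log N)) ∑ |u(m)|² m^{-2α}`"; Ivić 1985 Thm 5.3),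
proved along the printed route (Gallagher's lemma + the integral mean value theorem) in the
sharper form available for coefficients supported on `[N, M]`: the factor `log M` of the printed
statement (the tree's `Gallagher.discreteMeanValue`) is replaced by `log(M/N)` through the twist —
for `N = 1` it is the printed statement up to the explicit constants.
[cite: Huxley1972, Ch. 18, (18.27)–(18.29)] -/
theorem discreteMeanValue_dyadic (a : ℕ → ℂ) {N M : ℕ} (hN : 1 ≤ N) (hNM : N ≤ M)
    (ha : ∀ n, n < N → a n = 0) {T δ : ℝ} (hT : 0 < T) (hδ : 0 < δ)
    (𝒯 : Finset ℝ) (hmem : ∀ t ∈ 𝒯, |t| ≤ T)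
    (hsep : ∀ t ∈ 𝒯, ∀ t' ∈ 𝒯, t ≠ t' → δ ≤ |t - t'|) :
    ∑ t ∈ 𝒯, ‖∑ n ∈ Finset.Icc 1 M, a n * (n : ℂ) ^ (-((t : ℂ) * I))‖ ^ 2 ≤
      (5 * (T + δ / 2) + 18 * M) * (δ⁻¹ + Real.log ((M : ℝ) / N)) *
        ∑ n ∈ Finset.Icc 1 M, ‖a n‖ ^ 2 := by
  -- the polynomial, the twist, the derivative data
  set P : ℝ → ℂ := fun t ↦ ∑ n ∈ Finset.Icc 1 M, a n * phase n t with hP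
  set ψ : ℝ → ℂ := fun t ↦ Complex.exp (((t * Real.log N : ℝ) : ℂ) * I) with hψ
  set F : ℝ → ℂ := fun t ↦ ψ t * P t with hF
  set c : ℕ → ℂ := fun n ↦ a n * (((Real.log N - Real.log n : ℝ) : ℂ) * I) with hc
  set Q : ℝ → ℂ := fun t ↦ ∑ n ∈ Finset.Icc 1 M, c n * phase n t with hQ
  set F' : ℝ → ℂ := fun t ↦ ψ t * Q t with hF'
  set G : ℝ := ∑ n ∈ Finset.Icc 1 M, ‖a n‖ ^ 2 with hG
  set T' : ℝ := T + δ / 2 with hT'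
  set K : ℝ := 5 * T' + 18 * M with hK
  set L : ℝ := Real.log ((M : ℝ) / N) with hL
  have hT'0 : 0 < T' := by positivity
  have hK0 : 0 ≤ K := by positivity
  have hG0 : 0 ≤ G := Finset.sum_nonneg fun n _ ↦ sq_nonneg _
  have hN0 : (0 : ℝ) < N := by exact_mod_cast hN
  have hMN : (1 : ℝ) ≤ (M : ℝ) / N := by
    rw [le_div_iff₀ hN0, one_mul]; exact_mod_cast hNM
  have hL0 : 0 ≤ L := Real.log_nonneg hMN
  have hPeq : ∀ t : ℝ, ∑ n ∈ Finset.Icc 1 M, a n * (n : ℂ) ^ (-((t : ℂ) * I)) = P t :=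
    fun t ↦ dirichletPolynomial_eq_sum_phase a M t
  have hQeq : ∀ t : ℝ, ∑ n ∈ Finset.Icc 1 M, c n * (n : ℂ) ^ (-((t : ℂ) * I)) = Q t :=
    fun t ↦ dirichletPolynomial_eq_sum_phase c M t
  simp_rw [hPeq]
  -- the twist is unimodular
  have hψ1 : ∀ t, ‖ψ t‖ = 1 := fun t ↦ Complex.norm_exp_ofReal_mul_I _
  have hFn : ∀ t, ‖F t‖ = ‖P t‖ := fun t ↦ by
    simp only [hF, norm_mul, hψ1, one_mul]
  have hF'n : ∀ t, ‖F' t‖ = ‖Q t‖ := fun t ↦ by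
    simp only [hF', norm_mul, hψ1, one_mul]
  -- derivative and continuity
  have hψd : ∀ t, HasDerivAt ψ (ψ t * (((Real.log N : ℝ) : ℂ) * I)) t := by
    intro t
    have h1 : HasDerivAt (fun t : ℝ ↦ t * Real.log N) (Real.log N) t := by
      simpa using (hasDerivAt_id' t).mul_const (Real.log N)
    have h2 : HasDerivAt (fun t : ℝ ↦ (((t * Real.log N : ℝ)) : ℂ) * I)
        (((Real.log N : ℝ) : ℂ) * I) t := h1.ofReal_comp.mul_const I
    exact h2.cexp
  have hPd : ∀ t, HasDerivAt P
      (∑ n ∈ Finset.Icc 1 M, a n * (phase n t * ((-Real.log n : ℝ) * I))) t := by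
    intro t
    exact HasDerivAt.fun_sum (u := Finset.Icc 1 M) (x := t)
      (A := fun n t ↦ a n * phase n t)
      (A' := fun n ↦ a n * (phase n t * ((-Real.log n : ℝ) * I)))
      fun n _ ↦ (hasDerivAt_phase n t).const_mul (a n)
  have hderiv : ∀ t, HasDerivAt F (F' t) t := by
    intro t
    have h := (hψd t).mul (hPd t)
    have e : ψ t * (((Real.log N : ℝ) : ℂ) * I) * P t +
        ψ t * ∑ n ∈ Finset.Icc 1 M, a n * (phase n t * ((-Real.log n : ℝ) * I)) = F' t := by
      simp only [hF', hQ, hP, hc]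
      rw [mul_assoc, ← mul_add, Finset.mul_sum, ← Finset.sum_add_distrib]
      congr 1
      refine Finset.sum_congr rfl fun n _ ↦ ?_
      push_cast
      ring
    rw [← e]
    exact h
  have hψc : Continuous ψ := by
    simp only [hψ]
    fun_prop
  have hQc : Continuous Q :=
    continuous_finsetSum _ fun n _ ↦ continuous_const.mul (continuous_phase n)
  have hF'c : Continuous F' := hψc.mul hQc
  -- Gallagher on `[-T', T']`
  have hmem' : ∀ t ∈ 𝒯, -T' + δ / 2 ≤ t ∧ t ≤ T' - δ / 2 := by
    intro t ht
    have := abs_le.1 (hmem t ht)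
    constructor <;> · simp only [hT']; linarith
  have hgal := gallagher_first_lemma hderiv hF'c hδ (by linarith : -T' ≤ T') 𝒯 hmem' hsep
  simp_rw [hFn, hF'n] at hgal
  -- the two mean values
  have hmv : ∫ t in -T'..T', ‖P t‖ ^ 2 ≤ K * G := by
    have := dirichletPolynomial_meanSquare_le a M hT'0
    simp_rw [hPeq] at this
    exact this
  have hc2 : ∑ n ∈ Finset.Icc 1 M, ‖c n‖ ^ 2 ≤ L ^ 2 * G := by
    rw [hG, Finset.mul_sum]
    refine Finset.sum_le_sum fun n hn ↦ ?_
    rw [Finset.mem_Icc] at hn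
    by_cases hnN : n < N
    · simp [hc, ha n hnN]
    · rw [not_lt] at hnN
      have hn0 : (0 : ℝ) < n := by exact_mod_cast hn.1
      have hlog : 0 ≤ Real.log n - Real.log N := by
        rw [sub_nonneg]; exact Real.log_le_log hN0 (by exact_mod_cast hnN)
      have hlogle : Real.log n - Real.log N ≤ L := by
        have hM0 : (M : ℝ) ≠ 0 := by exact_mod_cast (show M ≠ 0 by omega)
        rw [hL, Real.log_div hM0 hN0.ne']
        exact sub_le_sub_right (Real.log_le_log hn0 (by exact_mod_cast hn.2)) _
      have e : ‖c n‖ = ‖a n‖ * (Real.log n - Real.log N) := by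
        simp only [hc, norm_mul, Complex.norm_I, mul_one, Complex.norm_real, Real.norm_eq_abs]
        rw [abs_sub_comm, abs_of_nonneg hlog]
      rw [e, mul_pow]
      have : (Real.log n - Real.log N) ^ 2 ≤ L ^ 2 := pow_le_pow_left₀ hlog hlogle 2
      nlinarith [sq_nonneg ‖a n‖]
  have hmv' : ∫ t in -T'..T', ‖Q t‖ ^ 2 ≤ K * (L ^ 2 * G) := by
    have := dirichletPolynomial_meanSquare_le c M hT'0
    simp_rw [hQeq] at this
    exact this.trans (mul_le_mul_of_nonneg_left hc2 hK0)
  -- combine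
  have hs1 : Real.sqrt (∫ t in -T'..T', ‖P t‖ ^ 2) ≤ Real.sqrt (K * G) := Real.sqrt_le_sqrt hmv
  have hs2 : Real.sqrt (∫ t in -T'..T', ‖Q t‖ ^ 2) ≤ L * Real.sqrt (K * G) := by
    calc Real.sqrt (∫ t in -T'..T', ‖Q t‖ ^ 2) ≤ Real.sqrt (K * (L ^ 2 * G)) :=
          Real.sqrt_le_sqrt hmv'
      _ = Real.sqrt (L ^ 2 * (K * G)) := by ring_nf
      _ = L * Real.sqrt (K * G) := by rw [Real.sqrt_mul (sq_nonneg _), Real.sqrt_sq hL0]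
  have hprod : Real.sqrt (∫ t in -T'..T', ‖P t‖ ^ 2) * Real.sqrt (∫ t in -T'..T', ‖Q t‖ ^ 2) ≤
      L * (K * G) := by
    calc _ ≤ Real.sqrt (K * G) * (L * Real.sqrt (K * G)) :=
          mul_le_mul hs1 hs2 (Real.sqrt_nonneg _) (Real.sqrt_nonneg _)
      _ = L * (Real.sqrt (K * G) * Real.sqrt (K * G)) := by ring
      _ = L * (K * G) := by rw [Real.mul_self_sqrt (by positivity)]
  have hfirst : δ⁻¹ * ∫ t in -T'..T', ‖P t‖ ^ 2 ≤ δ⁻¹ * (K * G) :=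
    mul_le_mul_of_nonneg_left hmv (by positivity)
  calc ∑ t ∈ 𝒯, ‖P t‖ ^ 2 ≤ δ⁻¹ * (∫ t in -T'..T', ‖P t‖ ^ 2) +
        Real.sqrt (∫ t in -T'..T', ‖P t‖ ^ 2) * Real.sqrt (∫ t in -T'..T', ‖Q t‖ ^ 2) := hgal
    _ ≤ δ⁻¹ * (K * G) + L * (K * G) := add_le_add hfirst hprod
    _ = (5 * (T + δ / 2) + 18 * M) * (δ⁻¹ + Real.log ((M : ℝ) / N)) * G := by
        simp only [hK, hT', hL]; ring

/-- The trivial bound for a `1`-bounded dyadic Dirichlet polynomial: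
`|∑_{n=N}^{2N} b_n n^{it}| ≤ N + 1` (`N ≥ 1`); a private helper. [folklore] -/
private theorem norm_sum_Icc_le {N : ℕ} (hN : 1 ≤ N) {b : ℕ → ℂ} (hb : ∀ n, ‖b n‖ ≤ 1) (t : ℝ) :
    ‖∑ n ∈ Finset.Icc N (2 * N), b n * (n : ℂ) ^ ((t : ℂ) * I)‖ ≤ (N : ℝ) + 1 := by
  calc ‖∑ n ∈ Finset.Icc N (2 * N), b n * (n : ℂ) ^ ((t : ℂ) * I)‖
      ≤ ∑ n ∈ Finset.Icc N (2 * N), ‖b n * (n : ℂ) ^ ((t : ℂ) * I)‖ := norm_sum_le _ _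
    _ ≤ ∑ n ∈ Finset.Icc N (2 * N), (1 : ℝ) := Finset.sum_le_sum fun n hn ↦ by
        rw [Finset.mem_Icc] at hn
        have hn0 : 0 < n := by omega
        have hre : ((t : ℂ) * I).re = 0 := by simp [Complex.mul_re]
        rw [norm_mul, Complex.norm_natCast_cpow_of_pos hn0, hre, Real.rpow_zero, mul_one]
        exact hb n
    _ = (N : ℝ) + 1 := by
        rw [Finset.sum_const, Nat.card_Icc, nsmul_eq_mul, mul_one]
        have : 2 * N + 1 - N = N + 1 := by omega
        rw [this]; push_cast; ring

/-- **The log-free mean value bound on real points** (the term `N²V⁻² + TNV⁻²` of Guth–Maynard's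
(1.1), "the classical Mean Value Theorem for Dirichlet polynomials", here WITHOUT the factor
`1 + log 2N` of the tree's `GuthMaynardReduction.largeValues_mvt`): if `|b_n| ≤ 1` and
`|∑_{N≤n≤2N} b_n n^{it}| ≥ V > 0` on a `1`-separated set `W ⊂ [0, T]` (`N, T ≥ 1`), then
`#W ≤ 2V⁻²(N+1)(5T + 3 + 36N)`. From `discreteMeanValue_dyadic` with `M = 2N`
(`1 + log 2 ≤ 2`). [cite: GuthMaynard2026, Section 1, (1.1) and Section 3] -/
theorem largeValues_mvt_logFree {T : ℝ} (hT : 1 ≤ T) {N : ℕ} (hN : 1 ≤ N) {b : ℕ → ℂ}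
    (hb : ∀ n, ‖b n‖ ≤ 1) {V : ℝ} (hV : 0 < V) (W : Finset ℝ)
    (hW : ∀ t ∈ W, 0 ≤ t ∧ t ≤ T) (hsep : ∀ t ∈ W, ∀ t' ∈ W, t ≠ t' → 1 ≤ |t - t'|)
    (hlarge : ∀ t ∈ W, V ≤ ‖∑ n ∈ Finset.Icc N (2 * N), b n * (n : ℂ) ^ ((t : ℂ) * I)‖) :
    (W.card : ℝ) ≤ V⁻¹ ^ 2 * (2 * (((N : ℝ) + 1) * (5 * T + 3 + 36 * N))) := by
  classical
  have hN0 : (0 : ℝ) < N := by exact_mod_cast hN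
  have hN1 : (1 : ℝ) ≤ N := by exact_mod_cast hN
  set a : ℕ → ℂ := fun n ↦ if n ∈ Finset.Icc N (2 * N) then (starRingEnd ℂ) (b n) else 0 with ha
  have hsub : Finset.Icc N (2 * N) ⊆ Finset.Icc 1 (2 * N) := fun n hn ↦ by
    rw [Finset.mem_Icc] at hn ⊢; omega
  have ha0 : ∀ n, n < N → a n = 0 := fun n hn ↦ by
    have : n ∉ Finset.Icc N (2 * N) := by rw [Finset.mem_Icc]; omega
    simp only [ha, this, if_false]
  have hsumeq : ∀ t : ℝ, ∑ n ∈ Finset.Icc 1 (2 * N), a n * (n : ℂ) ^ (-((t : ℂ) * I)) =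
      (starRingEnd ℂ) (∑ n ∈ Finset.Icc N (2 * N), b n * (n : ℂ) ^ ((t : ℂ) * I)) := by
    intro t
    rw [← Finset.sum_subset hsub (fun n _ hn ↦ by rw [ha]; dsimp only; rw [if_neg hn, zero_mul]),
      map_sum]
    refine Finset.sum_congr rfl fun n hn ↦ ?_
    rw [ha]; dsimp only; rw [if_pos hn, map_mul, GuthMaynardReduction.conj_natCast_cpow_mul_I]
  have hcoef : ∑ n ∈ Finset.Icc 1 (2 * N), ‖a n‖ ^ 2 ≤ (N : ℝ) + 1 := by
    rw [← Finset.sum_subset hsub (fun n _ hn ↦ by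
      rw [ha]; dsimp only; rw [if_neg hn, norm_zero]; ring)]
    have h1 : ∀ n ∈ Finset.Icc N (2 * N), ‖a n‖ ^ 2 ≤ 1 := by
      intro n hn
      rw [ha]; dsimp only; rw [if_pos hn, Complex.norm_conj]
      exact pow_le_one₀ (norm_nonneg _) (hb n)
    calc ∑ n ∈ Finset.Icc N (2 * N), ‖a n‖ ^ 2 ≤ ∑ n ∈ Finset.Icc N (2 * N), (1 : ℝ) :=
          Finset.sum_le_sum h1
      _ = (N : ℝ) + 1 := by
          rw [Finset.sum_const, Nat.card_Icc, nsmul_eq_mul, mul_one]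
          have : 2 * N + 1 - N = N + 1 := by omega
          rw [this]; push_cast; ring
  have hmem : ∀ t ∈ W, |t| ≤ T := fun t ht ↦ by
    have := hW t ht; rw [abs_of_nonneg this.1]; exact this.2
  have hMV := discreteMeanValue_dyadic a hN (by omega : N ≤ 2 * N) ha0 (by linarith : 0 < T)
    one_pos W hmem hsep
  simp only [inv_one] at hMV
  have hlog : Real.log (((2 * N : ℕ) : ℝ) / N) = Real.log 2 := by
    push_cast; rw [mul_div_assoc, div_self hN0.ne', mul_one]
  rw [hlog] at hMV
  have hlow : (W.card : ℝ) * V ^ 2 ≤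
      ∑ t ∈ W, ‖∑ n ∈ Finset.Icc 1 (2 * N), a n * (n : ℂ) ^ (-((t : ℂ) * I))‖ ^ 2 := by
    calc (W.card : ℝ) * V ^ 2 = ∑ _t ∈ W, V ^ 2 := by simp
      _ ≤ _ := Finset.sum_le_sum fun t ht ↦ by
          rw [hsumeq t, Complex.norm_conj]; exact pow_le_pow_left₀ hV.le (hlarge t ht) 2
  have hlog2 : Real.log 2 ≤ 1 := by
    have := Real.log_le_sub_one_of_pos (by norm_num : (0 : ℝ) < 2); linarith
  have hlog20 : 0 ≤ Real.log 2 := Real.log_nonneg (by norm_num)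
  have hK0 : 0 ≤ (5 * (T + 1 / 2) + 18 * ((2 * N : ℕ) : ℝ)) * (1 + Real.log 2) := by positivity
  have hup : ∑ t ∈ W, ‖∑ n ∈ Finset.Icc 1 (2 * N), a n * (n : ℂ) ^ (-((t : ℂ) * I))‖ ^ 2 ≤
      2 * (((N : ℝ) + 1) * (5 * T + 3 + 36 * N)) := by
    refine hMV.trans ?_
    calc (5 * (T + 1 / 2) + 18 * ((2 * N : ℕ) : ℝ)) * (1 + Real.log 2) *
          ∑ n ∈ Finset.Icc 1 (2 * N), ‖a n‖ ^ 2
        ≤ (5 * (T + 1 / 2) + 18 * ((2 * N : ℕ) : ℝ)) * (1 + Real.log 2) * ((N : ℝ) + 1) :=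
          mul_le_mul_of_nonneg_left hcoef hK0
      _ ≤ 2 * (((N : ℝ) + 1) * (5 * T + 3 + 36 * N)) := by
          push_cast
          have h1 : (5 * (T + 1 / 2) + 18 * (2 * (N : ℝ))) ≤ 5 * T + 3 + 36 * N := by linarith
          have h2 : 1 + Real.log 2 ≤ 2 := by linarith
          have h3 : 0 ≤ (N : ℝ) + 1 := by positivity
          have h4 : 0 ≤ 5 * (T + 1 / 2) + 18 * (2 * (N : ℝ)) := by positivity
          have h5 : 0 ≤ 1 + Real.log 2 := by positivity
          calc (5 * (T + 1 / 2) + 18 * (2 * (N : ℝ))) * (1 + Real.log 2) * ((N : ℝ) + 1)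
              ≤ (5 * T + 3 + 36 * N) * 2 * ((N : ℝ) + 1) := by gcongr
            _ = 2 * (((N : ℝ) + 1) * (5 * T + 3 + 36 * N)) := by ring
  have hV2 : 0 < V ^ 2 := by positivity
  calc (W.card : ℝ) = (W.card * V ^ 2) * V⁻¹ ^ 2 := by field_simp
    _ ≤ (2 * (((N : ℝ) + 1) * (5 * T + 3 + 36 * N))) * V⁻¹ ^ 2 :=
        mul_le_mul_of_nonneg_right (hlow.trans hup) (by positivity)
    _ = _ := by ring

/-! ## §3. From the tree's shape of Theorem 1.1 to the printed one -/

/-- **The printed Theorem 1.1 from its restricted form.** If for every `ε > 0` there are `C, T₀`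
such that the bound `#W ≤ C T^ε (N²V⁻² + N^{18/5}V⁻⁴ + TN^{12/5}V⁻⁴)` holds for all `T ≥ T₀` and
`1 ≤ N ≤ T` (the hypothesis `hLV` of the tree's `zeroDensity_guth_maynard_of_largeValues`, which is
the conclusion of `GuthMaynardReduction.largeValues_of_keyProp`), then it holds with one constant
for all `T ≥ 1` and all `N ≥ 1`: for `N > T` by the log-free mean value theorem
(`largeValues_mvt_logFree`: `#W ≤ 2V⁻²(N+1)(5T+3+36N) ≤ 176 N²V⁻²`, the paper's "Theorem 1.1
follows from (1.1) if `N ≥ T` since then `R ≤ T^{o(1)}N²V⁻²`"), and for `1 ≤ T < T₀` by the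
trivial count `#W ≤ T + 1` (`GuthMaynardReduction.card_le_of_one_sep`) and `N²V⁻² ≥ 1/4`
(`V ≤ N + 1 ≤ 2N` on a nonempty `W`). [cite: GuthMaynard2026, Section 3, proof of Theorem 1.1] -/
theorem theorem_1_1_of_restricted
    (hLV : ∀ ε : ℝ, 0 < ε → ∃ C T₀ : ℝ, ∀ T : ℝ, T₀ ≤ T →
      ∀ (N : ℕ) (b : ℕ → ℂ) (V : ℝ) (W : Finset ℝ), 1 ≤ N → (N : ℝ) ≤ T →
      (∀ n, ‖b n‖ ≤ 1) → 0 < V → (∀ t ∈ W, 0 ≤ t ∧ t ≤ T) →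
      (∀ t ∈ W, ∀ t' ∈ W, t ≠ t' → 1 ≤ |t - t'|) →
      (∀ t ∈ W, V ≤ ‖∑ n ∈ Finset.Icc N (2 * N), b n * (n : ℂ) ^ ((t : ℂ) * I)‖) →
      (W.card : ℝ) ≤ C * T ^ ε * ((N : ℝ) ^ 2 * V⁻¹ ^ 2 + (N : ℝ) ^ (18 / 5 : ℝ) * V⁻¹ ^ 4 +
        T * (N : ℝ) ^ (12 / 5 : ℝ) * V⁻¹ ^ 4)) :
    GuthMaynard2026_theorem_1_1 := by
  intro ε hε
  classical
  obtain ⟨C, T₀, hC⟩ := hLV ε hε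
  set T₁ : ℝ := max T₀ 1 with hT₁
  set C' : ℝ := max (max C 176) (4 * (T₁ + 1)) with hC'
  have hCC' : C ≤ C' := (le_max_left _ _).trans (le_max_left _ _)
  have h176 : (176 : ℝ) ≤ C' := (le_max_right _ _).trans (le_max_left _ _)
  have h4 : 4 * (T₁ + 1) ≤ C' := le_max_right _ _
  have hC'0 : 0 ≤ C' := le_trans (by norm_num) h176
  have hT₀T₁ : T₀ ≤ T₁ := le_max_left _ _
  refine ⟨C', fun T hT N b V W hN hb hV hW hsep hlarge ↦ ?_⟩
  have hN1 : (1 : ℝ) ≤ N := by exact_mod_cast hN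
  have hN0 : (0 : ℝ) < N := by linarith
  have hT0 : 0 < T := by linarith
  have hTε : 1 ≤ T ^ ε := Real.one_le_rpow hT hε.le
  set X : ℝ := (N : ℝ) ^ 2 * V⁻¹ ^ 2 + (N : ℝ) ^ (18 / 5 : ℝ) * V⁻¹ ^ 4 +
    T * (N : ℝ) ^ (12 / 5 : ℝ) * V⁻¹ ^ 4 with hX
  have hX0 : 0 ≤ X := by positivity
  have hX1 : (N : ℝ) ^ 2 * V⁻¹ ^ 2 ≤ X := by
    have : 0 ≤ (N : ℝ) ^ (18 / 5 : ℝ) * V⁻¹ ^ 4 + T * (N : ℝ) ^ (12 / 5 : ℝ) * V⁻¹ ^ 4 := by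
      positivity
    rw [hX]; linarith
  have hXT : X ≤ T ^ ε * X := le_mul_of_one_le_left hX0 hTε
  by_cases hNT : (N : ℝ) ≤ T
  · by_cases hTT : T₀ ≤ T
    · -- the tree's Theorem 1.1
      have h := hC T hTT N b V W hN hNT hb hV hW hsep hlarge
      exact h.trans (mul_le_mul_of_nonneg_right (mul_le_mul_of_nonneg_right hCC' (by positivity)) hX0)
    · -- `1 ≤ T < T₀`: trivial count
      rw [not_le] at hTT
      have hcard : (W.card : ℝ) ≤ T + 1 := GuthMaynardReduction.card_le_of_one_sep hT0.le W hW hsep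
      rcases W.eq_empty_or_nonempty with hWe | ⟨t, ht⟩
      · rw [hWe, Finset.card_empty, Nat.cast_zero]; positivity
      · have hVle : V ≤ 2 * N := by
          have := (hlarge t ht).trans (norm_sum_Icc_le hN hb t); linarith
        have hq : (1 : ℝ) / 4 ≤ (N : ℝ) ^ 2 * V⁻¹ ^ 2 := by
          have h1 : (1 : ℝ) / 2 ≤ N * V⁻¹ := by
            rw [le_mul_inv_iff₀ hV]; linarith
          have h0 : (0 : ℝ) ≤ 1 / 2 := by norm_num
          nlinarith [mul_le_mul h1 h1 h0 ((h0.trans h1))]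
        calc (W.card : ℝ) ≤ T + 1 := hcard
          _ ≤ T₁ + 1 := by linarith [hTT.le.trans hT₀T₁]
          _ = 4 * (T₁ + 1) * (1 / 4) := by ring
          _ ≤ C' * (T ^ ε * X) :=
              mul_le_mul h4 (hq.trans (hX1.trans hXT)) (by norm_num) hC'0
          _ = C' * T ^ ε * X := by ring
  · -- `N > T`: the log-free mean value theorem
    rw [not_le] at hNT
    have h := largeValues_mvt_logFree hT hN hb hV W hW hsep hlarge
    have h2 : 2 * (((N : ℝ) + 1) * (5 * T + 3 + 36 * N)) ≤ 176 * (N : ℝ) ^ 2 := by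
      nlinarith
    calc (W.card : ℝ) ≤ V⁻¹ ^ 2 * (2 * (((N : ℝ) + 1) * (5 * T + 3 + 36 * N))) := h
      _ ≤ V⁻¹ ^ 2 * (176 * (N : ℝ) ^ 2) := mul_le_mul_of_nonneg_left h2 (by positivity)
      _ = 176 * ((N : ℝ) ^ 2 * V⁻¹ ^ 2) := by ring
      _ ≤ C' * (T ^ ε * X) := mul_le_mul h176 (hX1.trans hXT) (by positivity) hC'0
      _ = C' * T ^ ε * X := by ring

end GuthMaynardLargeValues

/-! ## §4. Theorem 1.1 holds -/

/-- **Guth–Maynard's Theorem 1.1 holds as printed.** Proposition 3.1 for the weight `w` of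
`GuthMaynardAssembly.exists_weight` is assembled exactly as in
`GuthMaynardAssembly.zeroDensity_guth_maynard_of_bounds` (§12: `keyProp_of_bounds` from
Propositions 6.1 (`GuthMaynardS2.S2_bound`), 10.1 (`GuthMaynardS3Final.S3_bound`) and 11.1
(`GuthMaynardEnergyBound.energy_bound`)); §3 of the paper is
`GuthMaynardReduction.largeValues_of_keyProp`; the cases `N > T` and `T < T₀(ε)` are
`GuthMaynardLargeValues.theorem_1_1_of_restricted`.
[cite: GuthMaynard2026, Theorem 1.1, Section 3 and Section 12] -/
theorem GuthMaynard2026_theorem_1_1_holds : GuthMaynard2026_theorem_1_1 := by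
  obtain ⟨w, hw, hsupp, hw1, hw01⟩ := GuthMaynardAssembly.exists_weight
  have hwb : ∀ u, |w u| ≤ 1 := fun u ↦ by
    rw [abs_le]; constructor <;> linarith [(hw01 u).1, (hw01 u).2]
  exact GuthMaynardLargeValues.theorem_1_1_of_restricted
    (GuthMaynardReduction.largeValues_of_keyProp hw1
      (GuthMaynardAssembly.keyProp_of_bounds hw hsupp hwb
        (fun _ hε _ hδ ↦ GuthMaynardS2.S2_bound hw hsupp hε hδ)
        (fun ε hε δ hδ ↦ GuthMaynardS3Final.S3_bound w hw hsupp hw1 hw01 ε hε δ hδ)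
        GuthMaynardEnergyBound.energy_bound))

/-- The printed Theorem 1.1 in the tree's hypothesis shape `hLV` (`T ≥ T₀ := 1`, the unused
restriction `N ≤ T` added) — the input of `zeroDensity_guth_maynard_of_largeValues` (§13.1).
[cite: GuthMaynard2026, Theorem 1.1] -/
theorem GuthMaynard2026_theorem_1_1.largeValues_hLV (h : GuthMaynard2026_theorem_1_1) :
    ∀ ε : ℝ, 0 < ε → ∃ C T₀ : ℝ, ∀ T : ℝ, T₀ ≤ T →
      ∀ (N : ℕ) (b : ℕ → ℂ) (V : ℝ) (W : Finset ℝ), 1 ≤ N → (N : ℝ) ≤ T →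
      (∀ n, ‖b n‖ ≤ 1) → 0 < V → (∀ t ∈ W, 0 ≤ t ∧ t ≤ T) →
      (∀ t ∈ W, ∀ t' ∈ W, t ≠ t' → 1 ≤ |t - t'|) →
      (∀ t ∈ W, V ≤ ‖∑ n ∈ Finset.Icc N (2 * N), b n * (n : ℂ) ^ ((t : ℂ) * I)‖) →
      (W.card : ℝ) ≤ C * T ^ ε * ((N : ℝ) ^ 2 * V⁻¹ ^ 2 + (N : ℝ) ^ (18 / 5 : ℝ) * V⁻¹ ^ 4 +
        T * (N : ℝ) ^ (12 / 5 : ℝ) * V⁻¹ ^ 4) := by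
  intro ε hε
  obtain ⟨C, hC⟩ := h ε hε
  exact ⟨C, 1, fun T hT N b V W hN _ hb hV hW hsep hlarge ↦ hC T hT N b V W hN hb hV hW hsep hlarge⟩

/-- **The uniform and the eventual readings of `T^{o(1)}` agree for Theorem 1.1**: the printed
statement with one constant for all `T ≥ 1` (`GuthMaynard2026_theorem_1_1`) is equivalent to the
literal §1.2 reading "for every `ε > 0` there are `C, T₀` such that for all `T ≥ T₀` …" (small `T`
are absorbed by `#W ≤ T + 1` and `N²V⁻² ≥ 1/4`, `GuthMaynardLargeValues.theorem_1_1_of_restricted`).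
[cite: GuthMaynard2026, Theorem 1.1 and Section 1.2] -/
theorem GuthMaynard2026_theorem_1_1_iff_eventually :
    GuthMaynard2026_theorem_1_1 ↔
    ∀ ε : ℝ, 0 < ε → ∃ C T₀ : ℝ, ∀ T : ℝ, T₀ ≤ T →
      ∀ (N : ℕ) (b : ℕ → ℂ) (V : ℝ) (W : Finset ℝ), 1 ≤ N →
      (∀ n, ‖b n‖ ≤ 1) → 0 < V → (∀ t ∈ W, 0 ≤ t ∧ t ≤ T) →
      (∀ t ∈ W, ∀ t' ∈ W, t ≠ t' → 1 ≤ |t - t'|) →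
      (∀ t ∈ W, V ≤ ‖∑ n ∈ Finset.Icc N (2 * N), b n * (n : ℂ) ^ ((t : ℂ) * I)‖) →
      (W.card : ℝ) ≤ C * T ^ ε * ((N : ℝ) ^ 2 * V⁻¹ ^ 2 + (N : ℝ) ^ (18 / 5 : ℝ) * V⁻¹ ^ 4 +
        T * (N : ℝ) ^ (12 / 5 : ℝ) * V⁻¹ ^ 4) := by
  constructor
  · intro h ε hε
    obtain ⟨C, hC⟩ := h ε hε
    exact ⟨C, 1, fun T hT N b V W hN hb hV hW hsep hlarge ↦ hC T hT N b V W hN hb hV hW hsep hlarge⟩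
  · intro h
    refine GuthMaynardLargeValues.theorem_1_1_of_restricted fun ε hε ↦ ?_
    obtain ⟨C, T₀, hC⟩ := h ε hε
    exact ⟨C, T₀, fun T hT N b V W hN _ hb hV hW hsep hlarge ↦ hC T hT N b V W hN hb hV hW hsep hlarge⟩

/-- **Theorem 1.1 ⇒ Theorem 1.2 through the tree's §13.1**: the printed Theorem 1.1 implies the
named fact `zeroDensity_guth_maynard` (`zeroDensity_guth_maynard_of_largeValues`, zero detection and
Huxley's theorem on `[4/5, 1]`). [cite: GuthMaynard2026, Section 13.1] -/
theorem zeroDensity_guth_maynard_of_theorem_1_1 (h : GuthMaynard2026_theorem_1_1) :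
    zeroDensity_guth_maynard :=
  zeroDensity_guth_maynard_of_largeValues h.largeValues_hLV

/-! ## §5. Theorem 1.2 as printed holds -/

/-- **Guth–Maynard's Theorem 1.2 holds as printed** (on the whole range `1/2 ≤ σ ≤ 1`): on
`[7/10, 1]` it is the tree's `zeroDensity_guth_maynard_holds` (Theorem 1.2 proper, with Huxley's
theorem on `[4/5, 1]`), on `[1/2, 7/10]` Ingham's theorem `zeroDensity_ingham_holds` with
`3/(2−σ) ≤ 15/(3+5σ) ⟺ σ ≤ 7/10` (`ingham_exponent_le_guth_maynard_iff`); the tree packages both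
as `zeroDensityEstimate_guth_maynard_half_iff`. [cite: GuthMaynard2026, Theorem 1.2] -/
theorem GuthMaynard2026_theorem_1_2_holds : GuthMaynard2026_theorem_1_2 :=
  zeroDensityEstimate_guth_maynard_half_iff.2 zeroDensity_guth_maynard_holds

/-- The printed Theorem 1.2 restricted to `σ ≥ 7/10` is the tree's named fact
`zeroDensity_guth_maynard`, and conversely. [cite: GuthMaynard2026, Theorem 1.2] -/
theorem GuthMaynard2026_theorem_1_2_iff : GuthMaynard2026_theorem_1_2 ↔ zeroDensity_guth_maynard :=
  zeroDensityEstimate_guth_maynard_half_iff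

/-- The `30/13` display following Theorem 1.2 ("Combining this with Ingham's estimate when
`σ ≤ 7/10`, we obtain `N(σ,T) ≤ T^{30(1−σ)/13+o(1)}`") from the printed Theorem 1.2 — the tree's
`zeroDensity_thirty_thirteenths_of_guth_maynard`; unconditionally `zeroDensity_thirty_thirteenths_holds`.
[cite: GuthMaynard2026, Theorem 1.2 and the display following it] -/
theorem zeroDensity_thirty_thirteenths_of_theorem_1_2 (h : GuthMaynard2026_theorem_1_2) :
    zeroDensity_thirty_thirteenths :=
  zeroDensity_thirty_thirteenths_of_guth_maynard (GuthMaynard2026_theorem_1_2_iff.1 h)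

/-! ## §6. Theorem 1.6 (Heath-Brown) as printed holds -/

/-- **Guth–Maynard's Theorem 1.6 holds as printed** (constant `6`, `T₀ = max(T₀(ε), 1)`): from
the tree's `HeathBrownDZS.heathBrown_differenceSet` (`N < n ≤ 2N`, `|a_n| ≤ 1`, constant `2`)
applied to `a_n/A`, adding the term `n = N` with `|x + y|² ≤ 2|x|² + 2|y|²` and
`∑_{t₁,t₂} |a_N N^{i(t₁−t₂)}|² ≤ A²|𝒯|² ≤ A² T^ε |𝒯|²N`.
[cite: GuthMaynard2026, Theorem 1.6] [cite: Heathbrown1979, Theorem 1] -/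
theorem GuthMaynard2026_theorem_1_6_holds : GuthMaynard2026_theorem_1_6 := by
  intro ε hε
  classical
  obtain ⟨T₀, hT₀⟩ := HeathBrownDZS.heathBrown_differenceSet hε
  refine ⟨6, max T₀ 1, fun T hT 𝒯 T₁ h𝒯 hsep N hN A a ha ↦ ?_⟩
  have hTT₀ : T₀ ≤ T := (le_max_left _ _).trans hT
  have hT1 : 1 ≤ T := (le_max_right _ _).trans hT
  have hT0 : 0 < T := by linarith
  have hTε : 1 ≤ T ^ ε := Real.one_le_rpow hT1 hε.le
  have hN1 : (1 : ℝ) ≤ N := by exact_mod_cast hN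
  have hA0 : 0 ≤ A := (norm_nonneg _).trans (ha 0)
  set B : ℝ := (𝒯.card : ℝ) ^ 2 * N + 𝒯.card * (N : ℝ) ^ 2 +
    (𝒯.card : ℝ) ^ (5 / 4 : ℝ) * T ^ (1 / 2 : ℝ) * N with hB
  have hB0 : 0 ≤ B := by positivity
  have hB1 : (𝒯.card : ℝ) ^ 2 ≤ B := by
    have h1 : (𝒯.card : ℝ) ^ 2 ≤ (𝒯.card : ℝ) ^ 2 * N := le_mul_of_one_le_right (sq_nonneg _) hN1
    have h2 : 0 ≤ 𝒯.card * (N : ℝ) ^ 2 + (𝒯.card : ℝ) ^ (5 / 4 : ℝ) * T ^ (1 / 2 : ℝ) * N := by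
      positivity
    rw [hB]; linarith
  -- normalised coefficients
  set a' : ℕ → ℂ := fun n ↦ if A = 0 then 0 else (A : ℂ)⁻¹ * a n with ha'
  have ha'1 : ∀ n, ‖a' n‖ ≤ 1 := by
    intro n
    by_cases hA : A = 0
    · simp only [ha', hA, if_true, norm_zero]; norm_num
    · have hApos : 0 < A := lt_of_le_of_ne hA0 (Ne.symm hA)
      simp only [ha', hA, if_false, norm_mul, norm_inv, Complex.norm_real, Real.norm_eq_abs,
        abs_of_pos hApos]
      rw [inv_mul_le_iff₀ hApos, mul_one]
      exact ha n
  have haa' : ∀ n, a n = (A : ℂ) * a' n := by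
    intro n
    by_cases hA : A = 0
    · have : a n = 0 := by
        have := ha n; rw [hA] at this; exact norm_le_zero_iff.1 this
      simp [ha', hA, this]
    · simp only [ha', hA, if_false]
      rw [← mul_assoc, mul_inv_cancel₀ (by exact_mod_cast hA), one_mul]
  have hmain := hT₀ T hTT₀ 𝒯 T₁ h𝒯 hsep N hN a' ha'1
  -- split off the term `n = N`
  set S : ℝ → ℂ := fun u ↦ ∑ n ∈ Finset.Ioc N (2 * N), a' n * (n : ℂ) ^ ((u : ℂ) * I) with hS
  have hsplit : ∀ u : ℝ, ∑ n ∈ Finset.Icc N (2 * N), a n * (n : ℂ) ^ ((u : ℂ) * I) =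
      a N * (N : ℂ) ^ ((u : ℂ) * I) + (A : ℂ) * S u := by
    intro u
    rw [← Finset.Ioc_insert_left (by omega : N ≤ 2 * N), Finset.sum_insert Finset.left_notMem_Ioc,
      hS]
    dsimp only
    rw [Finset.mul_sum]
    congr 1
    refine Finset.sum_congr rfl fun n _ ↦ ?_
    rw [haa' n]; ring
  have hfirst : ∀ u : ℝ, ‖a N * (N : ℂ) ^ ((u : ℂ) * I)‖ ≤ A := by
    intro u
    have hre : ((u : ℂ) * I).re = 0 := by simp [Complex.mul_re]
    rw [norm_mul, Complex.norm_natCast_cpow_of_pos (by omega : 0 < N), hre, Real.rpow_zero, mul_one]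
    exact ha N
  have hterm : ∀ u : ℝ, ‖∑ n ∈ Finset.Icc N (2 * N), a n * (n : ℂ) ^ ((u : ℂ) * I)‖ ^ 2 ≤
      2 * A ^ 2 + 2 * A ^ 2 * ‖S u‖ ^ 2 := by
    intro u
    rw [hsplit u]
    have h1 := norm_add_le (a N * (N : ℂ) ^ ((u : ℂ) * I)) ((A : ℂ) * S u)
    have h2 : ‖(A : ℂ) * S u‖ = A * ‖S u‖ := by
      rw [norm_mul, Complex.norm_real, Real.norm_eq_abs, abs_of_nonneg hA0]
    have h3 := hfirst u
    have h4 : 0 ≤ ‖a N * (N : ℂ) ^ ((u : ℂ) * I) + (A : ℂ) * S u‖ := norm_nonneg _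
    have h5 : 0 ≤ ‖S u‖ := norm_nonneg _
    nlinarith [sq_nonneg (‖a N * (N : ℂ) ^ ((u : ℂ) * I)‖ - A * ‖S u‖), norm_nonneg (a N * (N : ℂ) ^ ((u : ℂ) * I))]
  -- sum over pairs
  have hsum : ∑ t₁ ∈ 𝒯, ∑ t₂ ∈ 𝒯,
        ‖∑ n ∈ Finset.Icc N (2 * N), a n * (n : ℂ) ^ (((t₁ - t₂ : ℝ) : ℂ) * I)‖ ^ 2 ≤
      ∑ t₁ ∈ 𝒯, ∑ t₂ ∈ 𝒯, (2 * A ^ 2 + 2 * A ^ 2 * ‖S (t₁ - t₂)‖ ^ 2) :=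
    Finset.sum_le_sum fun t₁ _ ↦ Finset.sum_le_sum fun t₂ _ ↦ hterm (t₁ - t₂)
  have hexp : ∑ t₁ ∈ 𝒯, ∑ t₂ ∈ 𝒯, (2 * A ^ 2 + 2 * A ^ 2 * ‖S (t₁ - t₂)‖ ^ 2) =
      2 * A ^ 2 * (𝒯.card : ℝ) ^ 2 + 2 * A ^ 2 * ∑ t₁ ∈ 𝒯, ∑ t₂ ∈ 𝒯, ‖S (t₁ - t₂)‖ ^ 2 := by
    simp only [Finset.sum_add_distrib, Finset.sum_const, nsmul_eq_mul, Finset.mul_sum]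
    ring
  have hmain' : ∑ t₁ ∈ 𝒯, ∑ t₂ ∈ 𝒯, ‖S (t₁ - t₂)‖ ^ 2 ≤ 2 * T ^ ε * B := by
    simpa only [hS, hB] using hmain
  calc ∑ t₁ ∈ 𝒯, ∑ t₂ ∈ 𝒯,
        ‖∑ n ∈ Finset.Icc N (2 * N), a n * (n : ℂ) ^ (((t₁ - t₂ : ℝ) : ℂ) * I)‖ ^ 2
      ≤ 2 * A ^ 2 * (𝒯.card : ℝ) ^ 2 + 2 * A ^ 2 * ∑ t₁ ∈ 𝒯, ∑ t₂ ∈ 𝒯, ‖S (t₁ - t₂)‖ ^ 2 := by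
        rw [← hexp]; exact hsum
    _ ≤ 2 * A ^ 2 * (T ^ ε * B) + 2 * A ^ 2 * (2 * T ^ ε * B) := by
        gcongr
        · exact hB1.trans (le_mul_of_one_le_left hB0 hTε)
    _ = 6 * T ^ ε * A ^ 2 * B := by ring

end Literature.NumberTheory.LFunctions

end
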